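import Literature.NumberTheory.Transcendental.NesterenkoNormForm
import Mathlib.RingTheory.Ideal.GoingUp
import Mathlib.RingTheory.IntegralClosure.IntegrallyClosed
import Mathlib.FieldTheory.IsAlgClosed.Basic
import HarnessLib

/-!
# Towards LNM 1752 Ch. 3 Proposition 4.11, IX: specialising the generic section — the pointwise product formula

`Literature/NumberTheory/Transcendental/NesterenkoNormFormSpecialize.lean`. Ninth step of the
discharge of the named fact `NesterenkoPhilippon2001_ch3_prop_4_11` (Nesterenko–Philippon (eds.),
LNM 1752 (2001), Ch. 3 Prop. 4.11 = [Nes10, Prop. 1.4]); sequel of `NesterenkoNormForm.lean`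
(generic splitting `g = a ∏_σ ℓ_{β_σ}` in `Ω[w]`, norm form `G = a^q N(Q(ρ))` with
`G = a^q ∏_σ Q(β_σ)`).

We specialise these identities at a point `u⁰` of `K^{s(m+1)}`, `K` ANY algebraically closed field of
characteristic zero (`ℂ` for the archimedean estimates, `ℂ_p` for the `p`-adic ones), with
`a(u⁰) ≠ 0`:

* the elements `a β_{σ,k} ∈ Ω` are INTEGRAL over `A = ℚ[U']` (`isIntegral_aEmbPt`: `−β_{σ,l}` is a
  root of `P_l`, whose leading coefficient is `a`; `Polynomial.isIntegral_leadingCoeff_smul`), so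
  the `A`-algebra `S = A[a β_{σ,k}] ⊂ Ω` (`Hull`) is integral over `A`;
* by LYING OVER (`Ideal.exists_ideal_over_prime_of_isIntegral`) and the extension of embeddings into
  algebraically closed fields (`IsAlgClosed.lift`), the evaluation `A → K` at `u⁰` extends to a ring
  homomorphism `φ : S → K` (`exists_specialization`);
* applying `φ`: **the pointwise product formula** (`exists_pointwise`) — there are points
  `γ_σ ∈ K^{m+1}` (`σ` running over the `D` embeddings), zeros of `𝔭` on the hyperplanes
  `L₁(u⁰), …, L_s(u⁰)` with `γ_{σ,j} = 1`, such that
  `F(u⁰; w) = a(u⁰) ∏_σ (γ_σ · w)` in `K[w]`, and for every form `Q` of degree `q` and every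
  numerator `num ∈ A`, `a^N G = num` in `K'`, one has `num(u⁰) = a(u⁰)^{N+q} ∏_σ Q(γ_σ)`;
* such numerators exist (`exists_normForm_num`: `a^{qD} G` is integral over the integrally closed
  domain `A`, being `∏_σ Q(a β_σ)` in `Ω`).

Definitions here are plumbing with bodies (`aA`, `aEmbPt`, `hullGen`, `Hull`, `hEmb`, `ev`); no
named facts.

## References

* [NesterenkoPhilippon2001] LNM 1752 (2001), Ch. 3 §4, Prop. 4.4 (p. 38), Prop. 4.11 (pp. 40–41).
* [Nes10] Yu. V. Nesterenko, Proc. Steklov Inst. Math. 218 (1997) 294–331, §1.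
* [HodgePedoe1994] W. V. D. Hodge, D. Pedoe, *Methods of Algebraic Geometry* II, Ch. X §§8–11
  (specialisation of the generic points of a linear section).
-/

noncomputable section

open MvPolynomial Module

attribute [local instance] MvPolynomial.gradedAlgebra

namespace Literature.NumberTheory.Transcendental

namespace Nesterenko

variable {m : ℕ}

namespace GSec

variable (𝒢 : GSec m)

/-! ### The integral elements `a β_{σ,k}` -/

/-- `a = F(u₁, …, u_s; e_j) ∈ A`. [folklore] -/
abbrev aA : RU 𝒢.s m := aLead 𝒢.s 𝒢.j (chowForm 𝒢.𝔭 (𝒢.s + 1))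

/-- `a β_{σ,k} ∈ Ω`. [folklore] -/
def aEmbPt (σ : 𝒢.L0 →ₐ[𝒢.Kp] 𝒢.Om) (k : Fin (m + 1)) : 𝒢.Om := 𝒢.aOm * 𝒢.embPt σ k

/-- `a β_σ = a • β_σ`. [folklore] -/
theorem aEmbPt_eq_smul (σ : 𝒢.L0 →ₐ[𝒢.Kp] 𝒢.Om) : 𝒢.aEmbPt σ = 𝒢.aOm • 𝒢.embPt σ := by
  funext k; rfl

/-- `(a β_σ)_j = a`. [folklore] -/
theorem aEmbPt_j (σ : 𝒢.L0 →ₐ[𝒢.Kp] 𝒢.Om) : 𝒢.aEmbPt σ 𝒢.j = 𝒢.aOm := by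
  rw [aEmbPt, embPt_j, mul_one]

/-- `deg P_l = D` exactly. [folklore] -/
theorem natDegree_specLast_chowForm (l : Fin m) :
    (specLast 𝒢.s 𝒢.j l (chowForm 𝒢.𝔭 (𝒢.s + 1))).natDegree = ideg 𝒢.𝔭 (𝒢.s + 1) := by
  refine le_antisymm (natDegree_specLast_le 𝒢.s 𝒢.j l fun _ hγ =>
    sum_last_eq_ideg_of_mem_support_chowForm 𝒢.𝔭 𝒢.s hγ) (Polynomial.le_natDegree_of_ne_zero ?_)
  rw [coeff_specLast_eq_aLead 𝒢.s 𝒢.j l fun _ hγ => sum_last_eq_ideg_of_mem_support_chowForm 𝒢.𝔭 𝒢.s hγ]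
  exact aLead_chowForm_ne_zero 𝒢.prime 𝒢.hom 𝒢.rank 𝒢.chart

/-- The leading coefficient of `P_l` is `a`. [folklore] -/
theorem leadingCoeff_specLast_chowForm (l : Fin m) :
    (specLast 𝒢.s 𝒢.j l (chowForm 𝒢.𝔭 (𝒢.s + 1))).leadingCoeff = 𝒢.aA := by
  rw [Polynomial.leadingCoeff, natDegree_specLast_chowForm,
    coeff_specLast_eq_aLead 𝒢.s 𝒢.j l fun _ hγ => sum_last_eq_ideg_of_mem_support_chowForm 𝒢.𝔭 𝒢.s hγ]

/-- `−ρ_l ∈ 𝕃₀` is a root of `P_l` (over the ring map `A → K' → 𝕃₀`). [folklore] -/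
theorem eval₂_specLast_neg_rhoL0 (l : Fin m) :
    Polynomial.eval₂ ((algebraMap 𝒢.Kp 𝒢.L0).comp (algebraMap (RU 𝒢.s m) 𝒢.Kp))
      (-𝒢.rhoL0 (𝒢.j.succAbove l)) (specLast 𝒢.s 𝒢.j l (chowForm 𝒢.𝔭 (𝒢.s + 1))) = 0 := by
  apply (algebraMap 𝒢.L0 𝒢.LL).injective
  rw [Polynomial.hom_eval₂, map_zero, map_neg, algebraMap_rhoL0, ← RingHom.comp_assoc,
    ← IsScalarTower.algebraMap_eq, ← IsScalarTower.algebraMap_eq, ← Polynomial.aeval_def]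
  exact 𝒢.aeval_specLast_neg_rho l 𝒢.chowForm_mem

/-- **`−β_{σ,l}` is a root of `P_l`** (apply `σ`). [cite: NesterenkoPhilippon2001, Ch. 3 Prop. 4.11 (pp. 40–41)] -/
theorem aeval_specLast_neg_embPt (σ : 𝒢.L0 →ₐ[𝒢.Kp] 𝒢.Om) (l : Fin m) :
    Polynomial.aeval (-𝒢.embPt σ (𝒢.j.succAbove l)) (specLast 𝒢.s 𝒢.j l (chowForm 𝒢.𝔭 (𝒢.s + 1))) = 0 := by
  have h := congrArg σ (𝒢.eval₂_specLast_neg_rhoL0 l)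
  rw [map_zero, show σ (Polynomial.eval₂ _ _ _) = (σ : 𝒢.L0 →+* 𝒢.Om) (Polynomial.eval₂ _ _ _) from rfl,
    Polynomial.hom_eval₂, map_neg] at h
  have hcomp : (σ : 𝒢.L0 →+* 𝒢.Om).comp ((algebraMap 𝒢.Kp 𝒢.L0).comp (algebraMap (RU 𝒢.s m) 𝒢.Kp)) =
      algebraMap (RU 𝒢.s m) 𝒢.Om := by
    refine RingHom.ext fun x => ?_
    simp only [RingHom.comp_apply, RingHom.coe_coe, AlgHom.commutes]
    exact (IsScalarTower.algebraMap_apply (RU 𝒢.s m) 𝒢.Kp 𝒢.Om x).symm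
  rw [hcomp] at h
  rw [Polynomial.aeval_def]
  exact h

/-- **`a β_{σ,k}` is integral over `A = ℚ[U']`.** [cite: NesterenkoPhilippon2001, Ch. 3 Prop. 4.11 (pp. 40–41)] -/
theorem isIntegral_aEmbPt (σ : 𝒢.L0 →ₐ[𝒢.Kp] 𝒢.Om) (k : Fin (m + 1)) :
    IsIntegral (RU 𝒢.s m) (𝒢.aEmbPt σ k) := by
  refine Fin.succAboveCases 𝒢.j ?_ (fun l => ?_) k
  · rw [aEmbPt_j]
    exact isIntegral_algebraMap
  · have h := isIntegral_leadingCoeff_smul (R := RU 𝒢.s m) _ _ (𝒢.aeval_specLast_neg_embPt σ l)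
    rw [leadingCoeff_specLast_chowForm, smul_neg] at h
    have h' := h.neg
    rw [neg_neg, Algebra.smul_def] at h'
    exact h'

/-! ### The integral hull `S = A[a β_{σ,k}] ⊂ Ω` -/

/-- The generators `a β_{σ,k}`. [folklore] -/
def hullGen (p : (𝒢.L0 →ₐ[𝒢.Kp] 𝒢.Om) × Fin (m + 1)) : 𝒢.Om := 𝒢.aEmbPt p.1 p.2

/-- **`S = A[a β_{σ,k} : σ, k]`**, an integral extension of `A` inside `Ω`. [folklore] -/
def Hull : Subalgebra (RU 𝒢.s m) 𝒢.Om := Algebra.adjoin (RU 𝒢.s m) (Set.range 𝒢.hullGen)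

/-- Short-cut instance (the generic search times out). [folklore] -/
instance algebraHull : Algebra (RU 𝒢.s m) 𝒢.Hull := 𝒢.Hull.algebra

/-- Short-cut instance. [folklore] -/
instance smulHull : SMul (RU 𝒢.s m) 𝒢.Hull := Algebra.toSMul

/-- Short-cut instance. [folklore] -/
instance moduleHull : Module (RU 𝒢.s m) 𝒢.Hull := Algebra.toModule

/-- The structure map `A → S` coerced to `Ω`. [folklore] -/
theorem coe_algebraMap_Hull (x : RU 𝒢.s m) :
    ((algebraMap (RU 𝒢.s m) 𝒢.Hull x : 𝒢.Hull) : 𝒢.Om) = algebraMap (RU 𝒢.s m) 𝒢.Om x := rfl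

/-- `A → S` is injective. [folklore] -/
theorem algebraMap_Hull_injective : Function.Injective (algebraMap (RU 𝒢.s m) 𝒢.Hull) :=
  fun x y h => 𝒢.algebraMap_A_Om_injective (by
    rw [← coe_algebraMap_Hull, ← coe_algebraMap_Hull, h])

/-- `A → S` is injective (instance form). [folklore] -/
instance faithfulSMulHull : FaithfulSMul (RU 𝒢.s m) 𝒢.Hull :=
  (faithfulSMul_iff_algebraMap_injective _ _).mpr 𝒢.algebraMap_Hull_injective

/-- `a β_{σ,k} ∈ S`. [folklore] -/
theorem aEmbPt_mem_Hull (σ : 𝒢.L0 →ₐ[𝒢.Kp] 𝒢.Om) (k : Fin (m + 1)) : 𝒢.aEmbPt σ k ∈ 𝒢.Hull :=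
  Algebra.subset_adjoin ⟨(σ, k), rfl⟩

/-- `a β_σ` as a tuple of elements of `S`. [folklore] -/
def hEmb (σ : 𝒢.L0 →ₐ[𝒢.Kp] 𝒢.Om) (k : Fin (m + 1)) : 𝒢.Hull := ⟨𝒢.aEmbPt σ k, 𝒢.aEmbPt_mem_Hull σ k⟩

/-- `hEmb` coerced. [folklore] -/
theorem coe_hEmb (σ : 𝒢.L0 →ₐ[𝒢.Kp] 𝒢.Om) (k : Fin (m + 1)) : (𝒢.hEmb σ k : 𝒢.Om) = 𝒢.aEmbPt σ k := rfl

/-- `(a β_σ)_j = a` in `S`. [folklore] -/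
theorem hEmb_j (σ : 𝒢.L0 →ₐ[𝒢.Kp] 𝒢.Om) : 𝒢.hEmb σ 𝒢.j = algebraMap (RU 𝒢.s m) 𝒢.Hull 𝒢.aA :=
  Subtype.ext (by rw [coe_hEmb, aEmbPt_j]; rfl)

/-- **`S` is integral over `A`.** [folklore] -/
instance isIntegral_Hull : Algebra.IsIntegral (RU 𝒢.s m) 𝒢.Hull :=
  ⟨fun x => by
    have hle : 𝒢.Hull ≤ integralClosure (RU 𝒢.s m) 𝒢.Om := by
      refine Algebra.adjoin_le ?_
      rintro _ ⟨⟨σ, k⟩, rfl⟩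
      exact 𝒢.isIntegral_aEmbPt σ k
    have hx : IsIntegral (RU 𝒢.s m) (x : 𝒢.Om) := hle x.2
    exact (isIntegral_algHom_iff 𝒢.Hull.val Subtype.val_injective).mp hx⟩

/-! ### The specialisation homomorphism `φ : S → K` -/

section Specialize

variable {K : Type*} [Field K] [Algebra ℚ K] (u : Fin 𝒢.s × Fin (m + 1) → K)

/-- Evaluation at `u⁰`. [folklore] -/
def ev : RU 𝒢.s m →+* K := (aeval u : RU 𝒢.s m →ₐ[ℚ] K)

/-- `ev` unfolded. [folklore] -/
theorem ev_apply (x : RU 𝒢.s m) : 𝒢.ev u x = aeval u x := rfl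

variable [IsAlgClosed K]

/-- **The evaluation `A → K` at `u⁰` extends to the integral hull `S`** (lying over + extension of
embeddings into the algebraically closed field `K`). [folklore] -/
theorem exists_specialization :
    ∃ φ : 𝒢.Hull →+* K, ∀ x : RU 𝒢.s m, φ (algebraMap (RU 𝒢.s m) 𝒢.Hull x) = aeval u x := by
  set P : Ideal (RU 𝒢.s m) := RingHom.ker (𝒢.ev u) with hP
  haveI : P.IsPrime := RingHom.ker_isPrime _
  obtain ⟨𝔓, -, h𝔓, hcomap⟩ := Ideal.exists_ideal_over_prime_of_isIntegral (S := 𝒢.Hull) P ⊥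
    (by
      rw [← RingHom.ker_eq_comap_bot,
        (RingHom.injective_iff_ker_eq_bot _).mp 𝒢.algebraMap_Hull_injective]
      exact bot_le)
  haveI := h𝔓
  -- the quotients
  set P' : Ideal (RU 𝒢.s m) := 𝔓.comap (algebraMap (RU 𝒢.s m) 𝒢.Hull) with hP'
  haveI : P'.IsPrime := Ideal.comap_isPrime _ _
  have hker : ∀ x ∈ P', 𝒢.ev u x = 0 := fun x hx => by
    have hx' : x ∈ P := hcomap ▸ hx
    exact hx'
  -- short-cut instances on the quotients (the generic searches time out)
  letI algQ : Algebra (RU 𝒢.s m ⧸ P') (𝒢.Hull ⧸ 𝔓) := Ideal.Quotient.algebraQuotientOfLEComap le_rfl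
  letI : SMul (RU 𝒢.s m ⧸ P') (𝒢.Hull ⧸ 𝔓) := Algebra.toSMul
  letI : Module (RU 𝒢.s m ⧸ P') (𝒢.Hull ⧸ 𝔓) := Algebra.toModule
  letI algK : Algebra (RU 𝒢.s m ⧸ P') K := (Ideal.Quotient.lift P' (𝒢.ev u) hker).toAlgebra
  letI : SMul (RU 𝒢.s m ⧸ P') K := Algebra.toSMul
  letI : Module (RU 𝒢.s m ⧸ P') K := Algebra.toModule
  haveI : IsDomain (𝒢.Hull ⧸ 𝔓) := Ideal.Quotient.isDomain 𝔓
  haveI : IsDomain (RU 𝒢.s m ⧸ P') := Ideal.Quotient.isDomain P'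
  haveI : FaithfulSMul (RU 𝒢.s m ⧸ P') (𝒢.Hull ⧸ 𝔓) :=
    (faithfulSMul_iff_algebraMap_injective _ _).mpr Ideal.algebraMap_quotient_injective
  haveI : FaithfulSMul (RU 𝒢.s m ⧸ P') K :=
    (faithfulSMul_iff_algebraMap_injective _ _).mpr
      (RingHom.lift_injective_of_ker_le_ideal P' hker (by rw [hcomap]))
  haveI : Module.IsTorsionFree (RU 𝒢.s m ⧸ P') (𝒢.Hull ⧸ 𝔓) := FaithfulSMul.to_isTorsionFree _ _
  haveI : Module.IsTorsionFree (RU 𝒢.s m ⧸ P') K := FaithfulSMul.to_isTorsionFree _ _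
  haveI : Algebra.IsIntegral (RU 𝒢.s m ⧸ P') (𝒢.Hull ⧸ 𝔓) := Algebra.IsIntegral.quotient
  haveI : Algebra.IsAlgebraic (RU 𝒢.s m ⧸ P') (𝒢.Hull ⧸ 𝔓) := Algebra.IsIntegral.isAlgebraic
  let ψ : (𝒢.Hull ⧸ 𝔓) →ₐ[RU 𝒢.s m ⧸ P'] K := IsAlgClosed.lift
  refine ⟨ψ.toRingHom.comp (Ideal.Quotient.mk 𝔓), fun x => ?_⟩
  change ψ (Ideal.Quotient.mk 𝔓 (algebraMap (RU 𝒢.s m) 𝒢.Hull x)) = _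
  rw [show Ideal.Quotient.mk 𝔓 (algebraMap (RU 𝒢.s m) 𝒢.Hull x) =
      algebraMap (RU 𝒢.s m ⧸ P') (𝒢.Hull ⧸ 𝔓) (Ideal.Quotient.mk P' x) from rfl, AlgHom.commutes]
  change Ideal.Quotient.lift P' (𝒢.ev u) hker (Ideal.Quotient.mk P' x) = _
  rw [Ideal.Quotient.lift_mk, ev_apply]

end Specialize

/-! ### Identities in the hull `S` -/

/-- Evaluating a RATIONAL polynomial at `a β_σ` inside `S` (through the ring map `ℚ → A → S`; no
`ℚ`-algebra structure on `S` is used). [folklore] -/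
def aevalH (σ : 𝒢.L0 →ₐ[𝒢.Kp] 𝒢.Om) (P : Rx m) : 𝒢.Hull :=
  eval₂ ((algebraMap (RU 𝒢.s m) 𝒢.Hull).comp (algebraMap ℚ (RU 𝒢.s m))) (𝒢.hEmb σ) P

/-- A ring map out of `S` applied to `aevalH`. [folklore] -/
theorem ringHom_aevalH {T : Type*} [CommRing T] [Algebra ℚ T] (ψ : 𝒢.Hull →+* T)
    (σ : 𝒢.L0 →ₐ[𝒢.Kp] 𝒢.Om) (P : Rx m) :
    ψ (𝒢.aevalH σ P) = aeval (fun k => ψ (𝒢.hEmb σ k)) P := by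
  rw [aevalH, eval₂_comp_left, aeval_def,
    Subsingleton.elim (ψ.comp ((algebraMap (RU 𝒢.s m) 𝒢.Hull).comp (algebraMap ℚ (RU 𝒢.s m))))
      (algebraMap ℚ T)]
  rfl

/-- `aevalH` coerced to `Ω` is evaluation at `a β_σ`. [folklore] -/
theorem coe_aevalH (σ : 𝒢.L0 →ₐ[𝒢.Kp] 𝒢.Om) (P : Rx m) :
    (𝒢.aevalH σ P : 𝒢.Om) = aeval (𝒢.aEmbPt σ) P :=
  𝒢.ringHom_aevalH (𝒢.Hull.val : 𝒢.Hull →+* 𝒢.Om) σ P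

/-- `a β_σ` is a zero of `𝔭` (scaling, `𝔭` homogeneous), inside `S`. [folklore] -/
theorem aevalH_eq_zero (σ : 𝒢.L0 →ₐ[𝒢.Kp] 𝒢.Om) {P : Rx m} (hP : P ∈ 𝒢.𝔭) : 𝒢.aevalH σ P = 0 := by
  apply Subtype.val_injective
  rw [coe_aevalH, aEmbPt_eq_smul]
  exact NesterenkoK.aeval_smul_eq_zero_of_forall 𝒢.hom (fun Q hQ => 𝒢.aeval_embPt_eq_zero σ hQ) _ P hP

/-- `a β_σ` lies on the generic hyperplanes, inside `S`. [folklore] -/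
theorem sum_algebraMap_X_mul_hEmb (σ : 𝒢.L0 →ₐ[𝒢.Kp] 𝒢.Om) (i : Fin 𝒢.s) :
    ∑ k : Fin (m + 1), algebraMap (RU 𝒢.s m) 𝒢.Hull (X (i, k)) * 𝒢.hEmb σ k = 0 := by
  apply Subtype.val_injective
  change (𝒢.Hull.val : 𝒢.Hull →+* 𝒢.Om) (∑ k, algebraMap (RU 𝒢.s m) 𝒢.Hull (X (i, k)) * 𝒢.hEmb σ k) =
    (𝒢.Hull.val : 𝒢.Hull →+* 𝒢.Om) 0
  rw [map_sum, map_zero]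
  have h1 : ∀ k, (𝒢.Hull.val : 𝒢.Hull →+* 𝒢.Om) (algebraMap (RU 𝒢.s m) 𝒢.Hull (X (i, k)) * 𝒢.hEmb σ k) =
      𝒢.aOm * (algebraMap (RU 𝒢.s m) 𝒢.Om (X (i, k)) * 𝒢.embPt σ k) := fun k => by
    rw [map_mul]
    change algebraMap (RU 𝒢.s m) 𝒢.Om (X (i, k)) * (𝒢.aOm * 𝒢.embPt σ k) = _
    ring
  simp_rw [h1]
  rw [← Finset.mul_sum, sum_algebraMap_X_mul_embPt, mul_zero]

/-- `g` with coefficients in `S`. [folklore] -/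
def gHull : MvPolynomial (Fin (m + 1)) 𝒢.Hull :=
  map (algebraMap (RU 𝒢.s m) 𝒢.Hull) (lastBlock 𝒢.s (chowForm 𝒢.𝔭 (𝒢.s + 1)))

/-- `gHull` pushed to `Ω` is `gOm`. [folklore] -/
theorem map_val_gHull : map (𝒢.Hull.val : 𝒢.Hull →+* 𝒢.Om) 𝒢.gHull = 𝒢.gOm := by
  rw [gHull, map_map]
  rfl

/-- **The generic splitting inside `S[w]`**: `a^{D−1} g = ∏_σ ℓ_{a β_σ}`.
[cite: NesterenkoPhilippon2001, Ch. 3 Prop. 4.11 (pp. 40–41)] -/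
theorem gHull_identity :
    C (algebraMap (RU 𝒢.s m) 𝒢.Hull 𝒢.aA ^ (ideg 𝒢.𝔭 (𝒢.s + 1) - 1)) * 𝒢.gHull =
      ∏ σ : 𝒢.L0 →ₐ[𝒢.Kp] 𝒢.Om, (∑ k, C (𝒢.hEmb σ k) * X k) := by
  apply map_injective (𝒢.Hull.val : 𝒢.Hull →+* 𝒢.Om) Subtype.val_injective
  rw [map_mul, map_C, map_val_gHull, map_prod]
  have h1 : ∀ σ : 𝒢.L0 →ₐ[𝒢.Kp] 𝒢.Om,
      map (𝒢.Hull.val : 𝒢.Hull →+* 𝒢.Om) (∑ k, C (𝒢.hEmb σ k) * X k) =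
        C 𝒢.aOm * (∑ k, C (𝒢.embPt σ k) * X k) := fun σ => by
    rw [← linK_smul]
    simp only [map_sum, map_mul, map_C, map_X]
    rfl
  simp_rw [h1]
  rw [Finset.prod_mul_distrib, Finset.prod_const, Finset.card_univ, card_embeddings_eq_ideg,
    gOm_eq_C_mul_Nprod, Nprod, ← mul_assoc, ← map_mul, map_pow]
  change C (𝒢.aOm ^ (ideg 𝒢.𝔭 (𝒢.s + 1) - 1) * 𝒢.aOm) * _ = _
  rw [← pow_succ, Nat.sub_add_cancel 𝒢.one_le_ideg, map_pow]

/-- **The norm form inside `S`**: if `a^N G = num` in `K'` then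
`a^{qD} num = a^{N+q} ∏_σ Q(a β_σ)` in `S`, for a form `Q` of degree `q`.
[cite: NesterenkoPhilippon2001, Ch. 3 Prop. 4.11 (pp. 40–41)] -/
theorem normForm_identity {Q : Rx m} {q : ℕ} (hQh : Q.IsHomogeneous q) {num : RU 𝒢.s m} {N : ℕ}
    (hnum : algebraMap (RU 𝒢.s m) 𝒢.Kp num = algebraMap (RU 𝒢.s m) 𝒢.Kp 𝒢.aA ^ N * 𝒢.normForm Q q) :
    algebraMap (RU 𝒢.s m) 𝒢.Hull (𝒢.aA ^ (q * ideg 𝒢.𝔭 (𝒢.s + 1)) * num) =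
      algebraMap (RU 𝒢.s m) 𝒢.Hull 𝒢.aA ^ (N + q) * ∏ σ : 𝒢.L0 →ₐ[𝒢.Kp] 𝒢.Om, 𝒢.aevalH σ Q := by
  apply Subtype.val_injective
  change (𝒢.Hull.val : 𝒢.Hull →+* 𝒢.Om) (algebraMap (RU 𝒢.s m) 𝒢.Hull (𝒢.aA ^ (q * ideg 𝒢.𝔭 (𝒢.s + 1)) * num)) =
    (𝒢.Hull.val : 𝒢.Hull →+* 𝒢.Om) (algebraMap (RU 𝒢.s m) 𝒢.Hull 𝒢.aA ^ (N + q) *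
        ∏ σ : 𝒢.L0 →ₐ[𝒢.Kp] 𝒢.Om, 𝒢.aevalH σ Q)
  rw [map_mul (𝒢.Hull.val : 𝒢.Hull →+* 𝒢.Om), map_pow, map_prod]
  have hval : ∀ σ : 𝒢.L0 →ₐ[𝒢.Kp] 𝒢.Om, (𝒢.Hull.val : 𝒢.Hull →+* 𝒢.Om) (𝒢.aevalH σ Q) =
      𝒢.aOm ^ q * aeval (𝒢.embPt σ) Q := fun σ => by
    change (𝒢.aevalH σ Q : 𝒢.Om) = _
    rw [coe_aevalH, aEmbPt_eq_smul, NesterenkoK.aeval_smul_of_isHomogeneous hQh]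
  simp_rw [hval]
  change algebraMap (RU 𝒢.s m) 𝒢.Om (𝒢.aA ^ (q * ideg 𝒢.𝔭 (𝒢.s + 1)) * num) =
    𝒢.aOm ^ (N + q) * ∏ σ : 𝒢.L0 →ₐ[𝒢.Kp] 𝒢.Om, (𝒢.aOm ^ q * aeval (𝒢.embPt σ) Q)
  rw [Finset.prod_mul_distrib, Finset.prod_const, Finset.card_univ, card_embeddings_eq_ideg,
    map_mul, map_pow, IsScalarTower.algebraMap_apply (RU 𝒢.s m) 𝒢.Kp 𝒢.Om num, hnum, map_mul,
    map_pow, ← IsScalarTower.algebraMap_apply, algebraMap_normForm]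
  change 𝒢.aOm ^ _ * (𝒢.aOm ^ N * (𝒢.aOm ^ q * _)) = 𝒢.aOm ^ (N + q) * ((𝒢.aOm ^ q) ^ _ * _)
  ring

/-! ### Specialised points and the pointwise product formula -/

section Pointwise

variable {K : Type*} [Field K] [Algebra ℚ K] (u : Fin 𝒢.s × Fin (m + 1) → K)
  (φ : 𝒢.Hull →+* K)

/-- The specialised points `γ_σ = φ(a β_σ) / a(u⁰)`. [folklore] -/
def specPt (σ : 𝒢.L0 →ₐ[𝒢.Kp] 𝒢.Om) (k : Fin (m + 1)) : K := (aeval u 𝒢.aA)⁻¹ * φ (𝒢.hEmb σ k)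

variable {u φ} (hφ : ∀ x : RU 𝒢.s m, φ (algebraMap (RU 𝒢.s m) 𝒢.Hull x) = aeval u x)
  (hu : aeval u 𝒢.aA ≠ 0)
include hφ hu

omit hφ in
/-- `φ(a β_{σ,k}) = a(u⁰) γ_{σ,k}`. [folklore] -/
theorem phi_hEmb (σ : 𝒢.L0 →ₐ[𝒢.Kp] 𝒢.Om) (k : Fin (m + 1)) :
    φ (𝒢.hEmb σ k) = aeval u 𝒢.aA * 𝒢.specPt u φ σ k := by
  rw [specPt, ← mul_assoc, mul_inv_cancel₀ hu, one_mul]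

omit hφ in
/-- As tuples: `φ ∘ (a β_σ) = a(u⁰) • γ_σ`. [folklore] -/
theorem phi_hEmb_eq_smul (σ : 𝒢.L0 →ₐ[𝒢.Kp] 𝒢.Om) :
    (fun k => φ (𝒢.hEmb σ k)) = aeval u 𝒢.aA • 𝒢.specPt u φ σ :=
  funext fun k => 𝒢.phi_hEmb hu σ k

/-- **`γ_{σ,j} = 1`.** [cite: NesterenkoPhilippon2001, Ch. 3 Prop. 4.11 (pp. 40–41)] -/
theorem specPt_j (σ : 𝒢.L0 →ₐ[𝒢.Kp] 𝒢.Om) : 𝒢.specPt u φ σ 𝒢.j = 1 := by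
  rw [specPt, hEmb_j, hφ, inv_mul_cancel₀ hu]

omit hφ in
/-- **`γ_σ` is a zero of `𝔭`.** [cite: NesterenkoPhilippon2001, Ch. 3 Prop. 4.11 (pp. 40–41)] -/
theorem aeval_specPt_eq_zero (σ : 𝒢.L0 →ₐ[𝒢.Kp] 𝒢.Om) {P : Rx m} (hP : P ∈ 𝒢.𝔭) :
    aeval (𝒢.specPt u φ σ) P = 0 := by
  have h1 : ∀ Q ∈ 𝒢.𝔭, aeval (fun k => φ (𝒢.hEmb σ k)) Q = 0 := fun Q hQ => by
    rw [← ringHom_aevalH, 𝒢.aevalH_eq_zero σ hQ, map_zero]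
  have h2 : 𝒢.specPt u φ σ = (aeval u 𝒢.aA)⁻¹ • fun k => φ (𝒢.hEmb σ k) := by
    rw [𝒢.phi_hEmb_eq_smul hu, smul_smul, inv_mul_cancel₀ hu, one_smul]
  rw [h2]
  exact NesterenkoK.aeval_smul_eq_zero_of_forall 𝒢.hom h1 _ P hP

omit hu in
/-- **`γ_σ` lies on the hyperplanes `L₁(u⁰), …, L_s(u⁰)`.**
[cite: NesterenkoPhilippon2001, Ch. 3 Prop. 4.11 (pp. 40–41)] -/
theorem sum_u_mul_specPt (σ : 𝒢.L0 →ₐ[𝒢.Kp] 𝒢.Om) (i : Fin 𝒢.s) :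
    ∑ k : Fin (m + 1), u (i, k) * 𝒢.specPt u φ σ k = 0 := by
  have h1 : ∑ k : Fin (m + 1), u (i, k) * φ (𝒢.hEmb σ k) = 0 := by
    have := congrArg φ (𝒢.sum_algebraMap_X_mul_hEmb σ i)
    rw [map_sum, map_zero] at this
    rw [← this]
    refine Finset.sum_congr rfl fun k _ => ?_
    rw [map_mul, hφ, aeval_X]
  have h2 : ∑ k : Fin (m + 1), u (i, k) * 𝒢.specPt u φ σ k =
      (aeval u 𝒢.aA)⁻¹ * ∑ k : Fin (m + 1), u (i, k) * φ (𝒢.hEmb σ k) := by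
    rw [Finset.mul_sum]
    refine Finset.sum_congr rfl fun k _ => ?_
    rw [specPt]
    ring
  rw [h2, h1, mul_zero]

/-- **`F(u⁰; w) = a(u⁰) ∏_σ (γ_σ · w)` in `K[w]`.** [cite: NesterenkoPhilippon2001, Ch. 3 Prop. 4.4 (p. 38), Prop. 4.11 (pp. 40–41)] -/
theorem map_ev_lastBlock :
    map (𝒢.ev u) (lastBlock 𝒢.s (chowForm 𝒢.𝔭 (𝒢.s + 1))) =
      C (aeval u 𝒢.aA) * ∏ σ : 𝒢.L0 →ₐ[𝒢.Kp] 𝒢.Om, (∑ k, C (𝒢.specPt u φ σ k) * X k) := by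
  have hcomp : φ.comp (algebraMap (RU 𝒢.s m) 𝒢.Hull) = 𝒢.ev u := RingHom.ext hφ
  have h := congrArg (map φ) 𝒢.gHull_identity
  rw [map_mul, map_C, map_pow, hφ, C_pow, gHull, map_map, hcomp, map_prod] at h
  have h2 : ∀ σ : 𝒢.L0 →ₐ[𝒢.Kp] 𝒢.Om,
      map φ (∑ k, C (𝒢.hEmb σ k) * X k) = C (aeval u 𝒢.aA) * (∑ k, C (𝒢.specPt u φ σ k) * X k) :=
    fun σ => by
    rw [← linK_smul, ← 𝒢.phi_hEmb_eq_smul hu]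
    simp only [map_sum, map_mul, map_C, map_X]
  simp_rw [h2] at h
  rw [Finset.prod_mul_distrib, Finset.prod_const, Finset.card_univ, card_embeddings_eq_ideg] at h
  have hpow : (C (aeval u 𝒢.aA) : MvPolynomial (Fin (m + 1)) K) ^ ideg 𝒢.𝔭 (𝒢.s + 1) =
      C (aeval u 𝒢.aA) ^ (ideg 𝒢.𝔭 (𝒢.s + 1) - 1) * C (aeval u 𝒢.aA) := by
    rw [← pow_succ, Nat.sub_add_cancel 𝒢.one_le_ideg]
  rw [hpow, mul_assoc] at h
  have hne : (C (aeval u 𝒢.aA) : MvPolynomial (Fin (m + 1)) K) ^ (ideg 𝒢.𝔭 (𝒢.s + 1) - 1) ≠ 0 :=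
    pow_ne_zero _ (by rw [Ne, C_eq_zero]; exact hu)
  exact mul_left_cancel₀ hne h

/-- **The value of a numerator of the norm form: `num(u⁰) = a(u⁰)^{N+q} ∏_σ Q(γ_σ)`.**
[cite: NesterenkoPhilippon2001, Ch. 3 Prop. 4.11 (pp. 40–41)] -/
theorem aeval_num {Q : Rx m} {q : ℕ} (hQh : Q.IsHomogeneous q) {num : RU 𝒢.s m} {N : ℕ}
    (hnum : algebraMap (RU 𝒢.s m) 𝒢.Kp num = algebraMap (RU 𝒢.s m) 𝒢.Kp 𝒢.aA ^ N * 𝒢.normForm Q q) :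
    aeval u num = aeval u 𝒢.aA ^ (N + q) * ∏ σ : 𝒢.L0 →ₐ[𝒢.Kp] 𝒢.Om, aeval (𝒢.specPt u φ σ) Q := by
  have h := congrArg φ (𝒢.normForm_identity hQh hnum)
  rw [hφ, map_mul φ, map_pow φ, map_prod φ, hφ, map_mul, map_pow] at h
  have h2 : ∀ σ : 𝒢.L0 →ₐ[𝒢.Kp] 𝒢.Om,
      φ (𝒢.aevalH σ Q) = aeval u 𝒢.aA ^ q * aeval (𝒢.specPt u φ σ) Q := fun σ => by
    rw [ringHom_aevalH, 𝒢.phi_hEmb_eq_smul hu, NesterenkoK.aeval_smul_of_isHomogeneous hQh]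
  simp_rw [h2] at h
  rw [Finset.prod_mul_distrib, Finset.prod_const, Finset.card_univ, card_embeddings_eq_ideg,
    ← pow_mul] at h
  refine mul_left_cancel₀ (pow_ne_zero (q * ideg 𝒢.𝔭 (𝒢.s + 1)) hu) ?_
  rw [h]
  ring

end Pointwise

/-- **Pointwise product formula** (packaged). At every point `u⁰ ∈ K^{s(m+1)}` (`K` algebraically
closed of characteristic zero) with `a(u⁰) ≠ 0` there are points `γ_σ ∈ K^{m+1}`, indexed by the
`D` embeddings `σ : 𝕃₀ → Ω`, zeros of `𝔭` on the hyperplanes `L₁(u⁰), …, L_s(u⁰)`, with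
`γ_{σ,j} = 1`, such that `F(u⁰; w) = a(u⁰) ∏_σ (γ_σ · w)` and, for every form `Q` of degree `q` and
every numerator `num` of the norm form (`a^N G = num`), `num(u⁰) = a(u⁰)^{N+q} ∏_σ Q(γ_σ)`.
[cite: NesterenkoPhilippon2001, Ch. 3 Prop. 4.11 (pp. 40–41)] -/
theorem exists_pointwise {K : Type*} [Field K] [IsAlgClosed K] [Algebra ℚ K]
    (u : Fin 𝒢.s × Fin (m + 1) → K) (hu : aeval u 𝒢.aA ≠ 0) :
    ∃ γ : (𝒢.L0 →ₐ[𝒢.Kp] 𝒢.Om) → Fin (m + 1) → K,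
      (∀ σ, γ σ 𝒢.j = 1) ∧
      (∀ σ, ∀ P ∈ 𝒢.𝔭, aeval (γ σ) P = 0) ∧
      (∀ σ (i : Fin 𝒢.s), ∑ k : Fin (m + 1), u (i, k) * γ σ k = 0) ∧
      map (𝒢.ev u) (lastBlock 𝒢.s (chowForm 𝒢.𝔭 (𝒢.s + 1))) =
        C (aeval u 𝒢.aA) * ∏ σ, (∑ k, C (γ σ k) * X k) ∧
      (∀ {Q : Rx m} {q : ℕ}, Q.IsHomogeneous q → ∀ {num : RU 𝒢.s m} {N : ℕ},
        algebraMap (RU 𝒢.s m) 𝒢.Kp num = algebraMap (RU 𝒢.s m) 𝒢.Kp 𝒢.aA ^ N * 𝒢.normForm Q q →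
          aeval u num = aeval u 𝒢.aA ^ (N + q) * ∏ σ, aeval (γ σ) Q) := by
  obtain ⟨φ, hφ⟩ := 𝒢.exists_specialization u
  exact ⟨𝒢.specPt u φ, fun σ => 𝒢.specPt_j hφ hu σ, fun σ _ hP => 𝒢.aeval_specPt_eq_zero hu σ hP,
    fun σ i => 𝒢.sum_u_mul_specPt hφ σ i, 𝒢.map_ev_lastBlock hφ hu,
    fun hQh _ _ hnum => 𝒢.aeval_num hφ hu hQh hnum⟩

/-! ### Numerators of the norm form exist -/

/-- `A = ℚ[U']` is integrally closed (a UFD). [folklore] -/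
instance isIntegrallyClosed_A : IsIntegrallyClosed (RU 𝒢.s m) :=
  UniqueFactorizationMonoid.instIsIntegrallyClosed

/-- **`a^{qD} G` is a polynomial**: for a form `Q` of degree `q` there is `num ∈ A = ℚ[U']` with
`a^{qD} G = num` in `K'` (the element `∏_σ Q(a β_σ) · a^q` of the integral hull; `A` is integrally
closed). [cite: NesterenkoPhilippon2001, Ch. 3 Prop. 4.11 (pp. 40–41)] -/
theorem exists_normForm_num {Q : Rx m} {q : ℕ} (hQh : Q.IsHomogeneous q) :
    ∃ num : RU 𝒢.s m, algebraMap (RU 𝒢.s m) 𝒢.Kp num =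
      algebraMap (RU 𝒢.s m) 𝒢.Kp 𝒢.aA ^ (q * ideg 𝒢.𝔭 (𝒢.s + 1)) * 𝒢.normForm Q q := by
  set x : 𝒢.Kp := algebraMap (RU 𝒢.s m) 𝒢.Kp 𝒢.aA ^ (q * ideg 𝒢.𝔭 (𝒢.s + 1)) * 𝒢.normForm Q q
    with hx
  -- the image of `x` in `Ω` is the element `a^q ∏_σ Q(a β_σ)` of the hull
  set y : 𝒢.Hull := algebraMap (RU 𝒢.s m) 𝒢.Hull 𝒢.aA ^ q * ∏ σ : 𝒢.L0 →ₐ[𝒢.Kp] 𝒢.Om, 𝒢.aevalH σ Q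
    with hy
  have hxy : algebraMap 𝒢.Kp 𝒢.Om x = (y : 𝒢.Om) := by
    have hval : ∀ σ : 𝒢.L0 →ₐ[𝒢.Kp] 𝒢.Om, (𝒢.aevalH σ Q : 𝒢.Om) = 𝒢.aOm ^ q * aeval (𝒢.embPt σ) Q :=
      fun σ => by rw [coe_aevalH, aEmbPt_eq_smul, NesterenkoK.aeval_smul_of_isHomogeneous hQh]
    have hyval : (y : 𝒢.Om) = 𝒢.aOm ^ q * ∏ σ : 𝒢.L0 →ₐ[𝒢.Kp] 𝒢.Om, (𝒢.aevalH σ Q : 𝒢.Om) := by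
      change (𝒢.Hull.val : 𝒢.Hull →+* 𝒢.Om) y = _
      rw [hy, map_mul (𝒢.Hull.val : 𝒢.Hull →+* 𝒢.Om), map_pow (𝒢.Hull.val : 𝒢.Hull →+* 𝒢.Om),
        map_prod (𝒢.Hull.val : 𝒢.Hull →+* 𝒢.Om)]
      rfl
    rw [hyval]
    simp_rw [hval]
    rw [hx, map_mul, map_pow, ← IsScalarTower.algebraMap_apply, algebraMap_normForm,
      Finset.prod_mul_distrib, Finset.prod_const, Finset.card_univ, card_embeddings_eq_ideg, ← pow_mul]
    change 𝒢.aOm ^ _ * (𝒢.aOm ^ q * _) = 𝒢.aOm ^ q * (𝒢.aOm ^ _ * _)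
    ring
  have hyint : IsIntegral (RU 𝒢.s m) (y : 𝒢.Om) :=
    (isIntegral_algHom_iff 𝒢.Hull.val Subtype.val_injective).mpr (Algebra.IsIntegral.isIntegral y)
  rw [← hxy] at hyint
  have hxint : IsIntegral (RU 𝒢.s m) x :=
    (isIntegral_algHom_iff (IsScalarTower.toAlgHom (RU 𝒢.s m) 𝒢.Kp 𝒢.Om)
      (algebraMap 𝒢.Kp 𝒢.Om).injective).mp hyint
  exact IsIntegrallyClosed.isIntegral_iff.mp hxint

end GSec

end Nesterenko

end Literature.NumberTheory.Transcendental

end
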